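import Summits.CriticalPhenomena.Ising3DConformalLimit.Theorems.AnomalousForcesInteractionEtaPositiveSusceptibilityForm
import HarnessLib

/-!
# Entrances to the i.o. power gain `EtaGainIO` (split child of crux `EtaPositive`)

Support file for crux `EtaPositive` (stmt-CriticalPhenomena-2600) of route `AnomalousForcesInteraction`
(sub-problem `Ising3DConformalLimit`). Write `G(x) = ⟨σ₀σ_x⟩⁺_{β_c(3),0}` (`criticalTwoPoint 3`, sup norm
`‖·‖` on `ℤ³`), `Λ_L = [-L,L]³ ∩ ℤ³` (`box 3 L`), `B_L = Σ_{y ∈ Λ_L} G(y)²` (truncated bubble diagram). The crux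
is `EtaPositive := ∃ κ > 0, C, ∀ x ≠ 0, G(x) ≤ C ‖x‖^{-(1+κ)}`; the strategist's split (glue
`Cruxes.EtaPositive.SplitGlue.etaPositive_of_etaExists_of_etaGainIO`, p169603) isolates its SIGN half

  `EtaGainIO := ∃ κ > 0, C, ∀ N, ∃ x, N < ‖x‖ ∧ G(x) ≤ C ‖x‖^{-(1+κ)}`

(a power gain over the infrared bound at arbitrarily far sites; `⟺ ¬ HasIsingExponentEta 3 0`). This file
provides ENTRANCES into `EtaGainIO` in the formats the available regular-scale / subsequence technology
delivers (statements along ONE sequence of scales), all by Messager–Miracle-Solé monotonicity: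

* `etaGainIO_iff_axis_gain_io` — `EtaGainIO ⟺ ∃ κ > 0, C, ∀ N, ∃ m > N, G(m e₁) ≤ C m^{-(1+κ)}` (MMS sphere
  sandwich `G(3‖x‖_∞ e₁) ≤ G(x)`).
* `etaGainIO_of_boxSum_gain_io` — a susceptibility gain `Σ_{Λ_L} G ≤ C L^{2-κ}` along ONE sequence
  `L_k → ∞` gives `EtaGainIO` (MMS averaging: `(2L+1)³ G(3L e₁) ≤ Σ_{Λ_L} G`), exponent `min κ 1`.
* `etaGainIO_of_bubble_gain_io` — a bubble gain `B_L ≤ C L^{1-κ}` along one sequence gives `EtaGainIO`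
  (`(2L+1)³ G(3L e₁)² ≤ B_L`), exponent `min κ 1 / 2`.

The all-scales counterparts are equivalences with the crux itself: `EtaPositive_iff_boxSum_gain`
(`…EtaPositiveSusceptibilityForm`, p165244) and `EtaPositive_iff_bubble_gain` (`…EtaPositiveBubbleForm`).
All statements are unconditional bookkeeping about the nearest-neighbour Ising model on `ℤ³` (standard
axioms, no named fact); none of them is the open gain itself.
-/

noncomputable section

namespace Summit.CriticalPhenomena.Ising3DConformalLimit.AnomalousForcesInteractionEtaPositive

open Finset Literature.Probability.LatticeModels

/-! ### Small helpers -/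

/-- The axis point `m e₁ ∈ ℤ³` has norm `m`, and hence sup norm `m` (the sup-norm form is the landed
`Literature.Barriers.CriticalPhenomena.LongRangeIsing.supNorm_single_zero_natCast`, re-derived inline below
from `norm_single_axis` to keep the imports light). -/
theorem norm_single_axis_nat (m : ℕ) : ‖(Pi.single (0 : Fin 3) (m : ℤ) : Site 3)‖ = (m : ℝ) := by
  rw [norm_single_axis, Int.cast_natCast, abs_of_nonneg (Nat.cast_nonneg m)]

/-- **MMS averaging at `β_c(3)`**: for `3L ≤ ‖x‖_∞`, `(2L+1)³ G(x) ≤ Σ_{y ∈ Λ_L} G(y)`. -/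
theorem card_box_mul_criticalTwoPoint_le_boxSum {L : ℕ} {x : Site 3} (h : 3 * L ≤ Site.supNorm x) :
    (2 * (L : ℝ) + 1) ^ 3 * criticalTwoPoint 3 x ≤ ∑ y ∈ box 3 L, criticalTwoPoint 3 y := by
  have hcard : (#(box 3 L) : ℝ) = (2 * (L : ℝ) + 1) ^ 3 := by
    rw [card_box]; push_cast; ring
  rw [← hcard]
  exact card_box_mul_twoPointPlus_le_sum_box (d := 3) (criticalBeta_nonneg 3) h

/-- **MMS averaging at `β_c(3)`, squared**: for `3L ≤ ‖x‖_∞`, `(2L+1)³ G(x)² ≤ Σ_{y ∈ Λ_L} G(y)²`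
(pointwise `0 ≤ G(x) ≤ G(y)` for `y ∈ Λ_L`). -/
theorem card_box_mul_criticalTwoPoint_sq_le_bubble {L : ℕ} {x : Site 3} (h : 3 * L ≤ Site.supNorm x) :
    (2 * (L : ℝ) + 1) ^ 3 * criticalTwoPoint 3 x ^ 2 ≤ ∑ y ∈ box 3 L, criticalTwoPoint 3 y ^ 2 := by
  have hcard : (#(box 3 L) : ℝ) = (2 * (L : ℝ) + 1) ^ 3 := by
    rw [card_box]; push_cast; ring
  have hG0 : 0 ≤ criticalTwoPoint 3 x := twoPointPlus_nonneg_of_gks (criticalBeta_nonneg 3) x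
  calc (2 * (L : ℝ) + 1) ^ 3 * criticalTwoPoint 3 x ^ 2
      = ∑ _y ∈ box 3 L, criticalTwoPoint 3 x ^ 2 := by
        rw [Finset.sum_const, nsmul_eq_mul, hcard]
    _ ≤ ∑ y ∈ box 3 L, criticalTwoPoint 3 y ^ 2 := Finset.sum_le_sum fun y hy => by
        have hyx : 3 * Site.supNorm y ≤ Site.supNorm x :=
          (Nat.mul_le_mul_left 3 (mem_box_iff_supNorm_le.1 hy)).trans h
        exact pow_le_pow_left₀ hG0
          (twoPointPlus_le_of_mul_supNorm_le (d := 3) (criticalBeta_nonneg 3) hyx) 2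

/-- `3^{-(1+κ)} ≥ 1/9` for `κ ≤ 1`, in the form `L^{-(1+κ)} ≤ 9 (3L)^{-(1+κ)}` (`L > 0`). -/
theorem rpow_neg_le_nine_mul_rpow_three_mul {L κ : ℝ} (hL : 0 < L) (hκ1 : κ ≤ 1) :
    L ^ (-(1 + κ)) ≤ 9 * (3 * L) ^ (-(1 + κ)) := by
  have h3 : (3 * L) ^ (-(1 + κ)) = (3 : ℝ) ^ (-(1 + κ)) * L ^ (-(1 + κ)) :=
    Real.mul_rpow (by norm_num) hL.le
  have h9 : (1 / 9 : ℝ) ≤ (3 : ℝ) ^ (-(1 + κ)) := by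
    have h1 : (3 : ℝ) ^ (-(2 : ℝ)) ≤ (3 : ℝ) ^ (-(1 + κ)) :=
      Real.rpow_le_rpow_of_exponent_le (by norm_num) (by linarith)
    have h2 : (3 : ℝ) ^ (-(2 : ℝ)) = 1 / 9 := by
      rw [Real.rpow_neg (by norm_num), Real.rpow_two]; norm_num
    rwa [h2] at h1
  have ht : 0 ≤ L ^ (-(1 + κ)) := Real.rpow_nonneg hL.le _
  rw [h3]
  nlinarith

/-! ### The axis form of `EtaGainIO` -/

/-- **`EtaGainIO` ⟺ an i.o. power gain along the axis.** A power gain over the infrared bound at sites of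
arbitrarily large norm is equivalent to one along the axis sequence `m e₁` (`m` arbitrarily large):
`G(3‖x‖_∞ e₁) ≤ G(x)` (Messager–Miracle-Solé sphere sandwich) one way, `x = m e₁` the other. -/
theorem etaGainIO_iff_axis_gain_io : (∃ κ C : ℝ, 0 < κ ∧ ∀ N : ℕ, ∃ x : Literature.Probability.LatticeModels.Site 3, (N : ℝ) < ‖x‖ ∧ Literature.Probability.LatticeModels.criticalTwoPoint 3 x ≤ C * (‖x‖ : ℝ) ^ (-(1 + κ))) ↔ ∃ κ C : ℝ, 0 < κ ∧ ∀ N : ℕ, ∃ m : ℕ, N < m ∧ Literature.Probability.LatticeModels.criticalTwoPoint 3 (Pi.single 0 (m : ℤ)) ≤ C * (m : ℝ) ^ (-(1 + κ)) := by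
  constructor
  · rintro ⟨κ, C, hκ, h⟩
    refine ⟨κ, max C 0 * (3 : ℝ) ^ (1 + κ), hκ, fun N => ?_⟩
    obtain ⟨x, hNx, hGx⟩ := h N
    have hx0 : x ≠ 0 := by
      intro h0; rw [h0, norm_zero] at hNx; exact (not_lt.2 (Nat.cast_nonneg N)) hNx
    obtain ⟨hnorm, hn1⟩ := norm_eq_supNorm_and_one_le hx0
    set n : ℕ := Site.supNorm x with hndef
    have hn1' : 1 ≤ n := by exact_mod_cast hn1
    have hn0 : (0 : ℝ) < n := by exact_mod_cast hn1'
    refine ⟨3 * n, ?_, ?_⟩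
    · have : (N : ℝ) < n := by rwa [hnorm] at hNx
      have : N < n := by exact_mod_cast this
      omega
    · have hsand := (criticalTwoPoint_axis_sandwich (y := x) hn1').1
      have hC : C * (‖x‖ : ℝ) ^ (-(1 + κ)) ≤ max C 0 * (n : ℝ) ^ (-(1 + κ)) := by
        rw [hnorm]
        exact mul_le_mul_of_nonneg_right (le_max_left _ _) (Real.rpow_nonneg hn0.le _)
      have hpow : (n : ℝ) ^ (-(1 + κ)) = (3 : ℝ) ^ (1 + κ) * ((3 * n : ℕ) : ℝ) ^ (-(1 + κ)) := by
        push_cast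
        rw [Real.mul_rpow (by norm_num) hn0.le, ← mul_assoc, ← Real.rpow_add (by norm_num : (0:ℝ) < 3),
          show (1 + κ) + -(1 + κ) = 0 by ring, Real.rpow_zero, one_mul]
      calc criticalTwoPoint 3 (Pi.single 0 ((3 * n : ℕ) : ℤ)) ≤ criticalTwoPoint 3 x := hsand
        _ ≤ C * (‖x‖ : ℝ) ^ (-(1 + κ)) := hGx
        _ ≤ max C 0 * (n : ℝ) ^ (-(1 + κ)) := hC
        _ = max C 0 * (3 : ℝ) ^ (1 + κ) * ((3 * n : ℕ) : ℝ) ^ (-(1 + κ)) := by rw [hpow]; ring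
  · rintro ⟨κ, C, hκ, h⟩
    refine ⟨κ, C, hκ, fun N => ?_⟩
    obtain ⟨m, hNm, hGm⟩ := h N
    refine ⟨Pi.single 0 (m : ℤ), ?_, ?_⟩
    · rw [norm_single_axis_nat]; exact_mod_cast hNm
    · rw [norm_single_axis_nat]; exact hGm

/-! ### `EtaGainIO` from a susceptibility gain along one sequence of scales -/

/-- **`EtaGainIO` from an i.o. finite-size-scaling gain on the susceptibility** (the strategist's first lemma
of line `regularity_sign`): if `Σ_{y ∈ Λ_L} G(y) ≤ C L^{2-κ}` for SOME `κ > 0` along a sequence of scales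
`L → ∞`, then a power gain `κ' = min κ 1` over the infrared bound occurs at the sites `3L e₁`:
`(2L+1)³ G(3L e₁) ≤ Σ_{Λ_L} G ≤ C L^{2-κ'}` (Messager–Miracle-Solé averaging), so `G(3L e₁) ≤ 9C (3L)^{-(1+κ')}`. -/
theorem etaGainIO_of_boxSum_gain_io : (∃ κ C : ℝ, 0 < κ ∧ ∀ N : ℕ, ∃ L : ℕ, N < L ∧ ∑ y ∈ Literature.Probability.LatticeModels.box 3 L, Literature.Probability.LatticeModels.criticalTwoPoint 3 y ≤ C * (L : ℝ) ^ (2 - κ)) → ∃ κ C : ℝ, 0 < κ ∧ ∀ N : ℕ, ∃ x : Literature.Probability.LatticeModels.Site 3, (N : ℝ) < ‖x‖ ∧ Literature.Probability.LatticeModels.criticalTwoPoint 3 x ≤ C * (‖x‖ : ℝ) ^ (-(1 + κ)) := by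
  rintro ⟨κ, C, hκ, h⟩
  set κ' : ℝ := min κ 1 with hκ'def
  have hκ'0 : 0 < κ' := lt_min hκ one_pos
  have hκ'1 : κ' ≤ 1 := min_le_right _ _
  have hκ'κ : κ' ≤ κ := min_le_left _ _
  set C' : ℝ := max C 0 with hC'def
  have hC'0 : 0 ≤ C' := le_max_right _ _
  refine ⟨κ', 9 * C', hκ'0, fun N => ?_⟩
  obtain ⟨L, hNL, hbox⟩ := h N
  have hL1 : 1 ≤ L := by omega
  have hL1' : (1 : ℝ) ≤ L := by exact_mod_cast hL1
  have hL0 : (0 : ℝ) < L := by linarith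
  -- the box-sum bound with the smaller exponent and the non-negative constant
  have hbox' : ∑ y ∈ box 3 L, criticalTwoPoint 3 y ≤ C' * (L : ℝ) ^ (2 - κ') := by
    have hp0 : 0 ≤ (L : ℝ) ^ (2 - κ) := Real.rpow_nonneg hL0.le _
    calc ∑ y ∈ box 3 L, criticalTwoPoint 3 y ≤ C * (L : ℝ) ^ (2 - κ) := hbox
      _ ≤ C' * (L : ℝ) ^ (2 - κ) := mul_le_mul_of_nonneg_right (le_max_left _ _) hp0
      _ ≤ C' * (L : ℝ) ^ (2 - κ') :=
        mul_le_mul_of_nonneg_left (Real.rpow_le_rpow_of_exponent_le hL1' (by linarith)) hC'0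
  -- the site `x = 3L e₁`
  set x : Site 3 := Pi.single 0 ((3 * L : ℕ) : ℤ) with hxdef
  have hxnorm : ‖x‖ = ((3 * L : ℕ) : ℝ) := norm_single_axis_nat (3 * L)
  have hxn : Site.supNorm x = 3 * L := by
    have h1 := hxnorm; rw [Site.norm_eq_supNorm] at h1; exact_mod_cast h1
  refine ⟨x, ?_, ?_⟩
  · rw [hxnorm]; exact_mod_cast (show N < 3 * L by omega)
  · -- MMS: `(2L+1)³ G(x) ≤ Σ_{Λ_L} G ≤ C' L^{2-κ'}`
    have hMMS := card_box_mul_criticalTwoPoint_le_boxSum (L := L) (x := x) (by rw [hxn])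
    set P : ℝ := (2 * (L : ℝ) + 1) ^ 3 with hPdef
    have hP0 : 0 < P := by positivity
    have hPL : (L : ℝ) ^ 3 ≤ P := pow_le_pow_left₀ hL0.le (by linarith) 3
    have hPG : P * criticalTwoPoint 3 x ≤ C' * (L : ℝ) ^ (2 - κ') := hMMS.trans hbox'
    have hG : criticalTwoPoint 3 x ≤ C' * (L : ℝ) ^ (2 - κ') / (L : ℝ) ^ 3 := by
      have h1 : criticalTwoPoint 3 x ≤ C' * (L : ℝ) ^ (2 - κ') / P := by
        rw [le_div_iff₀ hP0]; linarith
      exact h1.trans (div_le_div_of_nonneg_left (by positivity) (by positivity) hPL)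
    -- exponent bookkeeping `L^{2-κ'} / L³ = L^{-(1+κ')} ≤ 9 (3L)^{-(1+κ')}`
    have hpow : (L : ℝ) ^ (2 - κ') / (L : ℝ) ^ 3 = (L : ℝ) ^ (-(1 + κ')) := by
      have hL3 : (L : ℝ) ^ 3 = (L : ℝ) ^ (3 : ℝ) := by rw [← Real.rpow_natCast]; norm_num
      rw [hL3, ← Real.rpow_sub hL0]
      congr 1; ring
    have h9 : (L : ℝ) ^ (-(1 + κ')) ≤ 9 * (‖x‖ : ℝ) ^ (-(1 + κ')) := by
      rw [hxnorm]; push_cast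
      exact rpow_neg_le_nine_mul_rpow_three_mul hL0 hκ'1
    calc criticalTwoPoint 3 x ≤ C' * (L : ℝ) ^ (2 - κ') / (L : ℝ) ^ 3 := hG
      _ = C' * (L : ℝ) ^ (-(1 + κ')) := by rw [mul_div_assoc, hpow]
      _ ≤ C' * (9 * (‖x‖ : ℝ) ^ (-(1 + κ'))) := mul_le_mul_of_nonneg_left h9 hC'0
      _ = 9 * C' * (‖x‖ : ℝ) ^ (-(1 + κ')) := by ring

/-! ### `EtaGainIO` from a bubble gain along one sequence of scales -/

/-- **`EtaGainIO` from an i.o. gain on the bubble diagram**: if `B_L = Σ_{y ∈ Λ_L} G(y)² ≤ C L^{1-κ}` for SOME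
`κ > 0` along a sequence of scales `L → ∞` (a power gain over the infrared growth `B_L ≲ L` of the truncated
bubble diagram at `β_c(3)`), then `EtaGainIO` holds with exponent `min κ 1 / 2`:
`(2L+1)³ G(3L e₁)² ≤ B_L` (pointwise Messager–Miracle-Solé, squared). -/
theorem etaGainIO_of_bubble_gain_io : (∃ κ C : ℝ, 0 < κ ∧ ∀ N : ℕ, ∃ L : ℕ, N < L ∧ ∑ y ∈ Literature.Probability.LatticeModels.box 3 L, Literature.Probability.LatticeModels.criticalTwoPoint 3 y ^ 2 ≤ C * (L : ℝ) ^ (1 - κ)) → ∃ κ C : ℝ, 0 < κ ∧ ∀ N : ℕ, ∃ x : Literature.Probability.LatticeModels.Site 3, (N : ℝ) < ‖x‖ ∧ Literature.Probability.LatticeModels.criticalTwoPoint 3 x ≤ C * (‖x‖ : ℝ) ^ (-(1 + κ)) := by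
  rintro ⟨κ, C, hκ, h⟩
  set κ' : ℝ := min κ 1 with hκ'def
  have hκ'0 : 0 < κ' := lt_min hκ one_pos
  have hκ'1 : κ' ≤ 1 := min_le_right _ _
  have hκ'κ : κ' ≤ κ := min_le_left _ _
  set C' : ℝ := max C 0 with hC'def
  have hC'0 : 0 ≤ C' := le_max_right _ _
  refine ⟨κ' / 2, 9 * Real.sqrt C', by positivity, fun N => ?_⟩
  obtain ⟨L, hNL, hbub⟩ := h N
  have hL1 : 1 ≤ L := by omega
  have hL1' : (1 : ℝ) ≤ L := by exact_mod_cast hL1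
  have hL0 : (0 : ℝ) < L := by linarith
  have hbub' : ∑ y ∈ box 3 L, criticalTwoPoint 3 y ^ 2 ≤ C' * (L : ℝ) ^ (1 - κ') := by
    have hp0 : 0 ≤ (L : ℝ) ^ (1 - κ) := Real.rpow_nonneg hL0.le _
    calc ∑ y ∈ box 3 L, criticalTwoPoint 3 y ^ 2 ≤ C * (L : ℝ) ^ (1 - κ) := hbub
      _ ≤ C' * (L : ℝ) ^ (1 - κ) := mul_le_mul_of_nonneg_right (le_max_left _ _) hp0
      _ ≤ C' * (L : ℝ) ^ (1 - κ') :=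
        mul_le_mul_of_nonneg_left (Real.rpow_le_rpow_of_exponent_le hL1' (by linarith)) hC'0
  set x : Site 3 := Pi.single 0 ((3 * L : ℕ) : ℤ) with hxdef
  have hxnorm : ‖x‖ = ((3 * L : ℕ) : ℝ) := norm_single_axis_nat (3 * L)
  have hxn : Site.supNorm x = 3 * L := by
    have h1 := hxnorm; rw [Site.norm_eq_supNorm] at h1; exact_mod_cast h1
  have hG0 : 0 ≤ criticalTwoPoint 3 x := twoPointPlus_nonneg_of_gks (criticalBeta_nonneg 3) x
  refine ⟨x, ?_, ?_⟩
  · rw [hxnorm]; exact_mod_cast (show N < 3 * L by omega)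
  · have hMMS := card_box_mul_criticalTwoPoint_sq_le_bubble (L := L) (x := x) (by rw [hxn])
    set P : ℝ := (2 * (L : ℝ) + 1) ^ 3 with hPdef
    have hP0 : 0 < P := by positivity
    have hPL : (L : ℝ) ^ 3 ≤ P := pow_le_pow_left₀ hL0.le (by linarith) 3
    have hPG : P * criticalTwoPoint 3 x ^ 2 ≤ C' * (L : ℝ) ^ (1 - κ') := hMMS.trans hbub'
    have hG2 : criticalTwoPoint 3 x ^ 2 ≤ C' * (L : ℝ) ^ (1 - κ') / (L : ℝ) ^ 3 := by
      have h1 : criticalTwoPoint 3 x ^ 2 ≤ C' * (L : ℝ) ^ (1 - κ') / P := by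
        rw [le_div_iff₀ hP0]; linarith
      exact h1.trans (div_le_div_of_nonneg_left (by positivity) (by positivity) hPL)
    -- `L^{1-κ'} / L³ = (L^{-(1+κ'/2)})²`
    have hpow : (L : ℝ) ^ (1 - κ') / (L : ℝ) ^ 3 = ((L : ℝ) ^ (-(1 + κ' / 2))) ^ 2 := by
      have hL3 : (L : ℝ) ^ 3 = (L : ℝ) ^ (3 : ℝ) := by rw [← Real.rpow_natCast]; norm_num
      rw [hL3, ← Real.rpow_sub hL0, ← Real.rpow_natCast, ← Real.rpow_mul hL0.le]
      congr 1; push_cast; ring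
    have hsq : criticalTwoPoint 3 x ^ 2 ≤ (Real.sqrt C' * (L : ℝ) ^ (-(1 + κ' / 2))) ^ 2 := by
      rw [mul_pow, Real.sq_sqrt hC'0, ← hpow, ← mul_div_assoc]
      exact hG2
    have ht0 : 0 ≤ Real.sqrt C' * (L : ℝ) ^ (-(1 + κ' / 2)) :=
      mul_nonneg (Real.sqrt_nonneg _) (Real.rpow_nonneg hL0.le _)
    have hG : criticalTwoPoint 3 x ≤ Real.sqrt C' * (L : ℝ) ^ (-(1 + κ' / 2)) :=
      (pow_le_pow_iff_left₀ hG0 ht0 two_ne_zero).1 hsq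
    have h9 : (L : ℝ) ^ (-(1 + κ' / 2)) ≤ 9 * (‖x‖ : ℝ) ^ (-(1 + κ' / 2)) := by
      rw [hxnorm]; push_cast
      exact rpow_neg_le_nine_mul_rpow_three_mul hL0 (by linarith)
    calc criticalTwoPoint 3 x ≤ Real.sqrt C' * (L : ℝ) ^ (-(1 + κ' / 2)) := hG
      _ ≤ Real.sqrt C' * (9 * (‖x‖ : ℝ) ^ (-(1 + κ' / 2))) :=
        mul_le_mul_of_nonneg_left h9 (Real.sqrt_nonneg _)
      _ = 9 * Real.sqrt C' * (‖x‖ : ℝ) ^ (-(1 + κ' / 2)) := by ring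

end Summit.CriticalPhenomena.Ising3DConformalLimit.AnomalousForcesInteractionEtaPositive
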